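import Literature.NumberTheory.EllipticCurves.LatticeInclusionIsogenyComplexPointsProofs
import Literature.NumberTheory.EllipticCurves.ShimuraSubgroupHeckeCongruence
import HarnessLib

/-!
# Route `EisensteinDepletionAtTwo`, crux `StarOptBNSF` (item stmt-BirchSwinnertonDyer-27047), line `nsf`
# v8/v9 — the ODD-DEGREE `ℚ`-isogeny from the `X₀(N)`-optimal curve to the `X₁(N)`-optimal curve
# at a level with a traceless prime

Cell `bsd-rank2` (HOME run/shared/lean/pub/bsd-rank2/), seat `bsd-rank2-eng-2` GEN 18; piece (C) of lead
star-p1 GEN 8's `E₁`-cut of the research stub of line `nsf` (STATUS 2026-08-28T12:38:36Z; planner p2 GEN 33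
v8 `stub_x0OptimalEtaleNSF`).  HONEST FRAMING: a helper lemma for an OPEN crux child; nothing here reads an
analytic rank; `StarOptBNSF` / `E1M_NSF` / BSD are NOT proved by this file (PARTITION D-0054: none — r_an ≥ 2,
summit axis S0).

THE LEMMA.  Let `f` be a normalised newform on `Γ₀(N)` with a TRACELESS prime `p ∣ N` (`a_p(f) = 0`, so
`p` is odd as soon as `N` is, but oddness of `p` is all that is used), and let `W₀, W₁/ℚ` be elliptic
curves with Néron-type period pairs `L₀, L₁` such that `Λ_{L₀} = q·Λ_f` (`q ∈ ℚˣ`; the `X₀(N)`-optimal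
curve in the binders `hin/hout` of the nsf stubs) and `c₁·Λ₁(f) ⊆ Λ_{L₁} ⊆ c₁·Λ_f` (`c₁ ∈ ℚˣ`; e.g. the
`X₁(N)`-optimal curve `Λ_{L₁} = c₁·Λ₁(f)`, `Λ₁(f) = periodLatticeGamma1 f ⊆ Λ_f`).  Then there is a
`ℚ`-isogeny `ψ : W₀ → W₁` of ODD degree.  Proof: Ling–Oesterlé `U_p = p` on the Shimura subgroup gives
`p·Λ_f ⊆ Λ₁(f)` (tree theorem `pMulLatticeLeGamma1OfTracelessPrime_holds`), so the rational multiplier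
`c = p c₁/q` satisfies `c·Λ_{L₀} = p c₁ Λ_f ⊆ c₁Λ₁(f) ⊆ Λ_{L₁}` and `p·Λ_{L₁} ⊆ p c₁ Λ_f = c·Λ_{L₀}`;
the `ℚ`-isogeny `z ↦ cz` (Silverman *AEC* VI.4.1(b), over `ℚ` by the tree's analytic descent) has kernel
`c⁻¹Λ_{L₁}/Λ_{L₀}` killed by the odd number `p`, hence odd degree
(`Literature.NumberTheory.EllipticCurves.exists_isogeny_odd_degree_of_isNeronLatticeOf`, eng-2 GEN 18).

* `exists_isogeny_odd_degree_of_traceless` — the lemma as stated (hypothesis-light: only the four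
  lattice inclusions, `IsNewform0 f`, `p` prime, `p ∣ N`, `a_p(f) = 0`, `p` odd).
* `exists_isogeny_odd_degree_toX1Optimal` — the same with the `X₁(N)`-side binder in its optimal form
  `Λ_{L₁} = c₁·Λ₁(f)` (hin₁/hout₁) and `¬ 2 ∣ N` instead of `Odd p`.

References: S. Ling, J. Oesterlé, *The Shimura subgroup of `J₀(N)`*, Astérisque 196–197 (1991) (`T_p = p`
on `Σ(N)`), via the tree's `ShimuraSubgroupHeckeCongruence`; J. H. Silverman, *AEC* (2009), Thm. VI.4.1(b);
G. Stevens, Invent. Math. 98 (1989), §2 (the `X₁(N)`-optimal curve `ℂ/c₁Λ₁(f)`).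
-/

set_option linter.dupNamespace false -- `Summit.BirchSwinnertonDyer.BirchSwinnertonDyer` (summit = problem, D-0017)
set_option autoImplicit false

noncomputable section

namespace Summit.BirchSwinnertonDyer.BirchSwinnertonDyer.Theorems.DepletionAtTwo.OddCover

open Literature.NumberTheory.EllipticCurves
open Literature.NumberTheory.EllipticCurves.ModularForms
open WeierstrassCurve

variable [Algebra (AlgebraicClosure ℚ) ℂ] [IsScalarTower ℚ (AlgebraicClosure ℚ) ℂ]

/-- **Odd-degree `ℚ`-isogeny `W₀ → W₁` at a traceless prime.**  `f` a newform on `Γ₀(N)` with a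
traceless ODD prime `p ∣ N`; `W₀, W₁/ℚ` elliptic with Néron-type period pairs `L₀, L₁`;
`q·Λ_f ⊆ Λ_{L₀} ⊆ q·Λ_f` and `c₁·Λ₁(f) ⊆ Λ_{L₁} ⊆ c₁·Λ_f` for `q, c₁ ∈ ℚˣ`.  Then some `ℚ`-isogeny
`ψ : W₀ → W₁` has odd degree (it is `z ↦ (p c₁/q) z`, whose kernel is killed by `p`).
[cite: SilvermanAEC2009, Thm. VI.4.1] -/
theorem exists_isogeny_odd_degree_of_traceless
    {N : ℕ} [NeZero N] (f : CuspForm (CongruenceSubgroup.Gamma0 N) 2) (hf : IsNewform0 f)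
    {p : ℕ} (hp : p.Prime) (hpN : p ∣ N) (hap : cuspCoeff f p = 0) (hpodd : Odd p)
    (W₀ W₁ : WeierstrassCurve ℚ) [W₀.IsElliptic] [W₁.IsElliptic] {L₀ L₁ : PeriodPair}
    (hL₀ : IsNeronLatticeOf (W₀.baseChange ℂ) L₀) (hL₁ : IsNeronLatticeOf (W₁.baseChange ℂ) L₁)
    {q : ℚ} (hq : q ≠ 0) (hin : ∀ z ∈ periodLattice f, (q : ℂ) * z ∈ L₀.lattice)
    (hout : ∀ z ∈ L₀.lattice, ∃ w ∈ periodLattice f, z = (q : ℂ) * w)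
    {c₁ : ℚ} (hc₁ : c₁ ≠ 0) (hin₁ : ∀ z ∈ periodLatticeGamma1 f, (c₁ : ℂ) * z ∈ L₁.lattice)
    (hout₁ : ∀ z ∈ L₁.lattice, ∃ w ∈ periodLattice f, z = (c₁ : ℂ) * w) :
    ∃ ψ : Isogeny W₀ W₁, Odd ψ.degree := by
  have hqC : (q : ℂ) ≠ 0 := by exact_mod_cast hq
  -- the multiplier `c = p c₁ / q`
  have hc : (p : ℚ) * c₁ / q ≠ 0 :=
    div_ne_zero (mul_ne_zero (by exact_mod_cast hp.ne_zero) hc₁) hq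
  refine exists_isogeny_odd_degree_of_isNeronLatticeOf hL₀ hL₁ hc ?_ hpodd ?_
  · -- `c Λ_{L₀} ⊆ Λ_{L₁}`: `c (q w) = c₁ (p w)` and `p w ∈ Λ₁(f)` (Ling–Oesterlé)
    intro z hz
    obtain ⟨w, hw, rfl⟩ := hout z hz
    have hpw : (p : ℂ) * w ∈ periodLatticeGamma1 f :=
      pMulLatticeLeGamma1OfTracelessPrime_holds N f hf p hp hpN hap w hw
    have h := hin₁ _ hpw
    convert h using 1
    push_cast
    field_simp
  · -- `p Λ_{L₁} ⊆ c Λ_{L₀}`: `p (c₁ v) = c (q v)` with `q v ∈ Λ_{L₀}`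
    intro w hw
    obtain ⟨v, hv, rfl⟩ := hout₁ w hw
    refine ⟨(q : ℂ) * v, hin v hv, ?_⟩
    push_cast
    field_simp

/-- **Odd-degree `ℚ`-isogeny from the `X₀(N)`-optimal to the `X₁(N)`-optimal curve of a class at an
odd level with a traceless prime** — the nsf-binder form: `Λ_{L₀} = q·Λ_f` (`hin/hout`),
`Λ_{L₁} = c₁·Λ₁(f)` (`hin₁/hout₁`), `N` odd, `p ∣ N` prime with `a_p(f) = 0`.
[cite: SilvermanAEC2009, Thm. VI.4.1] -/
theorem exists_isogeny_odd_degree_toX1Optimal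
    {N : ℕ} [NeZero N] (f : CuspForm (CongruenceSubgroup.Gamma0 N) 2) (hf : IsNewform0 f)
    (hN : ¬ 2 ∣ N) {p : ℕ} (hp : p.Prime) (hpN : p ∣ N) (hap : cuspCoeff f p = 0)
    (W₀ W₁ : WeierstrassCurve ℚ) [W₀.IsElliptic] [W₁.IsElliptic] {L₀ L₁ : PeriodPair}
    (hL₀ : IsNeronLatticeOf (W₀.baseChange ℂ) L₀) (hL₁ : IsNeronLatticeOf (W₁.baseChange ℂ) L₁)
    {q : ℚ} (hq : q ≠ 0) (hin : ∀ z ∈ periodLattice f, (q : ℂ) * z ∈ L₀.lattice)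
    (hout : ∀ z ∈ L₀.lattice, ∃ w ∈ periodLattice f, z = (q : ℂ) * w)
    {c₁ : ℚ} (hc₁ : c₁ ≠ 0) (hin₁ : ∀ z ∈ periodLatticeGamma1 f, (c₁ : ℂ) * z ∈ L₁.lattice)
    (hout₁ : ∀ z ∈ L₁.lattice, ∃ w ∈ periodLatticeGamma1 f, z = (c₁ : ℂ) * w) :
    ∃ ψ : Isogeny W₀ W₁, Odd ψ.degree := by
  have hp2 : p ≠ 2 := by
    rintro rfl
    exact hN hpN
  refine exists_isogeny_odd_degree_of_traceless f hf hp hpN hap (hp.odd_of_ne_two hp2) W₀ W₁ hL₀ hL₁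
    hq hin hout hc₁ hin₁ fun z hz ↦ ?_
  obtain ⟨w, hw, rfl⟩ := hout₁ z hz
  exact ⟨w, periodLatticeGamma1_le_periodLattice f hw, rfl⟩

end Summit.BirchSwinnertonDyer.BirchSwinnertonDyer.Theorems.DepletionAtTwo.OddCover

end
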